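import Summits.QuantumAdvantage.QuantumAdvantage.Theorems.CubicForrelationNearExactIsExactTwelveLevelFiveCPartnerDeadAt2932
import Summits.QuantumAdvantage.QuantumAdvantage.Theorems.CubicForrelationNearExactIsExactTwelveLevelSixEight768
import Summits.QuantumAdvantage.QuantumAdvantage.Theorems.CubicForrelationNearExactIsExactTwelveLevelSixBothAt2932

/-!
# Crux `CubicForrelation.NearExactIsExact` (stmt-QuantumAdvantage-14043) — n = 12: what a cubic pair with `29/32 ≤ Φ < 1` must look like after
  gen 23 — BOTH sides at level `≥ 6`, and each side is (β) `#Z = 768`, (γ) `#Z = 512 ∧ E_off = 256`, or (δ₀) `#Z = 512 ∧ e = 0 off Z ∧ #L = 32`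

Certificate seat `b2b-cforr-cert` (gen 23).  HONEST FRAMING: a kernel-checked REDUCTION (standard axioms) about cubic Boolean pairs on 12 bits; it does
NOT decide whether `29/32` is a value at `n = 12` and claims NO new value of `θ₁₂`.  NOT summit progress.  Plan for the three residual per-side
configurations: HOME/b2b-cforr-cert-g23/PLAN-N12-928-L6.md.

`tw23_boundary_reduction`: for cubic `f, g` with `29/32 ≤ Φ(f,g) < 1` there is `u''` with `W_g = 64u''` (`tw23_ge2932_levelSix`), `Σ e² = 768` for
`e = u'' − (−1)^f` (`tw22_levelSix_both_ge2932_reduction`, the partner being at level `≥ 6` too), and with `Z = {u'' even}`: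
(β) `#Z = 768`, or (γ) `#Z = 512` and the off-`Z` energy is exactly `256`, or (δ₀) `#Z = 512`, `e = 0` off `Z` and EXACTLY `32` points of `Z` have
`λ = (e − σ)/4` odd (`σ` = the mod-4 sign of `e`) — the branch `8 ∣ e` off `Z` with `#L ≤ 31` being dead by the ℓ¹ engine at budget `768`
(`tw23_levelSix_eight_partner_false768`).  By the symmetry `Φ(f,g) = Φ(g,f)` the same holds for `f`.

References: Ax (1964) / McEliece (1972); MacWilliams–Sloane (1977) Ch. 13–15; Carlet (2021) §5.2; O'Donnell (2014) §3.3.  Axioms: standard.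
-/

set_option linter.dupNamespace false -- D-0017: single-problem summit ⇒ `QuantumAdvantage.QuantumAdvantage` by design

noncomputable section

namespace Summit.QuantumAdvantage.QuantumAdvantage.Theorems.CubicForrelation.NearExactIsExact

open Finset
open Literature.Computability.QuantumComplexity
open Literature.Computability.QuantumComplexity.BuzetChailloux (bxor zeroVec bxor_bxor_cancel_left bxor_zeroVec zeroVec_bxor bxor_comm
  bxor_self)
open Literature.Computability.QuantumComplexity.DerivativeWalsh (W)

/-- **Boundary reduction at `29/32` (12 bits).**  See the module docstring.  NOT summit progress. [this work] -/
theorem tw23_boundary_reduction (f g : (Fin (6 + 6) → Bool) → Bool) (hf : IsDegLeFun 3 f) (hg : IsDegLeFun 3 g)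
    (hΦ : (29 / 32 : ℝ) ≤ forrelation f g) (hhi : forrelation f g < 1) :
    ∃ u'' : (Fin (6 + 6) → Bool) → ℤ, (∀ x, W (fun y => signOf (g y)) x = (2 : ℝ) ^ 6 * (u'' x : ℝ)) ∧
      forrelation f g = 29 / 32 ∧ (∑ x, (u'' x - sZ (f x)) ^ 2 : ℤ) = 768 ∧
      (#(univ.filter fun x : Fin (6 + 6) → Bool => ¬ Odd (u'' x)) = 768 ∨
       (#(univ.filter fun x : Fin (6 + 6) → Bool => ¬ Odd (u'' x)) = 512 ∧ ∑ x ∈ univ.filter (fun x => x ∉ (univ.filter fun x : Fin (6 + 6) → Bool => ¬ Odd (u'' x))), (u'' x - sZ (f x)) ^ 2 = 256) ∨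
       (#(univ.filter fun x : Fin (6 + 6) → Bool => ¬ Odd (u'' x)) = 512 ∧ (∀ y, y ∉ (univ.filter fun x : Fin (6 + 6) → Bool => ¬ Odd (u'' x)) → (u'' y - sZ (f y)) = 0) ∧
          #((univ.filter fun x : Fin (6 + 6) → Bool => ¬ Odd (u'' x)).filter fun x => Odd ((u'' x - sZ (f x) - sZ (decide ((u'' x - sZ (f x)) % 4 = 3))) / 4)) = 32)) := by
  classical
  obtain ⟨⟨u'', hu''⟩, ⟨wf, hwf⟩⟩ := tw23_ge2932_levelSix f g hf hg hΦ hhi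
  refine ⟨u'', hu'', ?_⟩
  obtain ⟨hΦeq, hB, htri⟩ := tw22_levelSix_both_ge2932_reduction f g hf hg u'' hu'' wf hwf hΦ hhi
  refine ⟨hΦeq, hB, ?_⟩
  rcases htri with h768 | ⟨h512, h256 | h8⟩
  · exact Or.inl h768
  · exact Or.inr (Or.inl ⟨h512, h256⟩)
  right; right
  refine ⟨h512, ?_⟩
  set Z := (univ.filter fun x : Fin (6 + 6) → Bool => ¬ Odd (u'' x)) with hZdef
  have hmemZ : ∀ x, x ∈ Z ↔ ¬ Odd (u'' x) := fun x => by simp [hZdef]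
  set e : (Fin (6 + 6) → Bool) → ℤ := fun x => u'' x - sZ (f x) with hedef
  -- `Z` is a 9-flat `x_Z ⊕ V₀`
  obtain ⟨xZ, hxZ⟩ : Z.Nonempty := card_pos.1 (by rw [h512]; norm_num)
  have hp : IsDegLeFun 3 (fun x => decide (Odd (u'' x))) :=
    stub_walshTower stub_axParity (6 + 6) 6 3 g u'' hg hu'' (by intro k hk hkn; omega)
  have hp' : IsDegLeFun (2 + 1) (fun x => decide (Odd (u'' x)) ^^ true) := tb_isDegLeFun_xor_const hp true
  have hfilt : (univ.filter fun x : Fin (6 + 6) → Bool => (decide (Odd (u'' x)) ^^ true) = true) = Z :=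
    filter_congr fun x _ => by simp
  have hmw := mw_flat_of_minweight 2 (fun x => decide (Odd (u'' x)) ^^ true) hp' (by rw [hfilt, h512]; norm_num)
  rw [hfilt] at hmw
  obtain ⟨h0, hadd, hcardV, hcoset⟩ := hmw
  set V₀ := univ.filter (fun a : Fin (6 + 6) → Bool => ∀ x,
    (decide (Odd (u'' (bxor x a))) ^^ true) = (decide (Odd (u'' x)) ^^ true)) with hV₀
  have hS : Z = V₀.image (bxor xZ) := hcoset xZ (by have h := (hmemZ xZ).1 hxZ; simpa using h)
  rw [h512] at hcardV
  -- odd points of `Z`: `e` odd, `e = σ + 4λ`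
  have heodd : ∀ x, x ∈ Z → Odd (e x) := by
    intro x hx
    have hev := Int.not_odd_iff_even.1 ((hmemZ x).1 hx)
    rcases tp_sZ_cases (f x) with hs | hs <;> simp only [e] <;> rw [hs]
    · exact Int.odd_sub.2 (iff_of_false (Int.not_odd_iff_even.2 hev) (by decide))
    · exact Int.odd_sub.2 (iff_of_false (Int.not_odd_iff_even.2 hev) (by decide))
  have hsq1 : ∀ x, x ∈ Z → 1 ≤ e x ^ 2 := by
    intro x hx
    have hodd' := Int.odd_iff.1 (heodd x hx)
    have : e x ≤ -1 ∨ 1 ≤ e x := by omega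
    rcases this with h | h <;> nlinarith
  set L := ((univ.filter fun x : Fin (6 + 6) → Bool => ¬ Odd (u'' x)).filter fun x => Odd ((u'' x - sZ (f x) - sZ (decide ((u'' x - sZ (f x)) % 4 = 3))) / 4)) with hLdef
  have hcost8 : ∀ x ∈ L, 9 ≤ e x ^ 2 := by
    intro x hx
    have hxZ' : x ∈ Z := (mem_filter.1 hx).1
    have hodd : Odd ((e x - sZ (decide (e x % 4 = 3))) / 4) := (mem_filter.1 hx).2
    have h0 := Int.odd_iff.1 (heodd x hxZ')
    have hmod : e x % 4 = 1 ∨ e x % 4 = 3 := by omega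
    have hne : e x ≠ 1 ∧ e x ≠ -1 := by
      constructor
      · intro h1; rw [h1] at hodd; norm_num [sZ] at hodd
      · intro h1; rw [h1] at hodd; norm_num [sZ] at hodd
    have : e x ≤ -3 ∨ 3 ≤ e x := by omega
    rcases this with h | h <;> nlinarith
  -- the budget split
  have hsplit : (∑ x, e x ^ 2 : ℤ) = ∑ x ∈ Z, e x ^ 2 + ∑ x ∈ univ.filter (fun x => x ∉ Z), e x ^ 2 := by
    rw [← sum_filter_add_sum_filter_not univ (fun x => x ∈ Z)]
    congr 1
    exact sum_congr (by ext x; simp) fun _ _ => rfl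
  change (∑ x, e x ^ 2 : ℤ) = 768 at hB
  have hZsum : ∑ x ∈ Z, e x ^ 2 = ∑ x ∈ L, e x ^ 2 + ∑ x ∈ Z.filter (fun x => x ∉ L), e x ^ 2 := by
    rw [← sum_filter_add_sum_filter_not Z (fun x => x ∈ L)]
    congr 1
    exact sum_congr (by ext x; simp only [mem_filter]; exact ⟨fun h => h.2, fun h => ⟨(mem_filter.1 h).1, h⟩⟩) fun _ _ => rfl
  have hLsum : 9 * (#L : ℤ) ≤ ∑ x ∈ L, e x ^ 2 := by
    have h1 : ∑ x ∈ L, (9 : ℤ) ≤ ∑ x ∈ L, e x ^ 2 := sum_le_sum fun x hx => hcost8 x hx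
    rwa [sum_const, nsmul_eq_mul, mul_comm] at h1
  have hRsum : ((#Z : ℤ) - #L) ≤ ∑ x ∈ Z.filter (fun x => x ∉ L), e x ^ 2 := by
    have h1 : ∑ x ∈ Z.filter (fun x => x ∉ L), (1 : ℤ) ≤ ∑ x ∈ Z.filter (fun x => x ∉ L), e x ^ 2 :=
      sum_le_sum fun x hx => hsq1 x (mem_filter.1 hx).1
    rw [sum_const, nsmul_eq_mul, mul_one] at h1
    have hc : #(Z.filter fun x => x ∉ L) + #L = #Z := by
      have hLZ : L ⊆ Z := filter_subset _ _
      have := card_filter_add_card_filter_not (s := Z) (fun x => x ∈ L)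
      rw [filter_mem_eq_inter, inter_eq_right.2 hLZ] at this
      omega
    have : ((#(Z.filter fun x => x ∉ L) : ℕ) : ℤ) = #Z - #L := by
      have := congrArg (fun n : ℕ => (n : ℤ)) hc; push_cast at this; linarith
    linarith
  have hoff_ge : (0 : ℤ) ≤ ∑ x ∈ univ.filter (fun x => x ∉ Z), e x ^ 2 := sum_nonneg fun x _ => sq_nonneg _
  -- the ℓ¹ engine kills `#L ≤ 31`
  by_cases hL31 : #L ≤ 31
  · exfalso
    have hlo : (7 / 8 : ℝ) < forrelation f g := by linarith
    exact tw23_levelSix_eight_partner_false768 768 le_rfl f g hf hg u'' hu'' wf hwf hlo hhi hB.le V₀ xZ h0 hadd hcardV hS h8 hL31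
  -- so `#L = 32` and the off-`Z` energy vanishes
  have hL32 : #L = 32 := by
    have h1 : (32 : ℤ) ≤ #L := by exact_mod_cast (show 32 ≤ #L by omega)
    have h2 : 9 * (#L : ℤ) + (512 - #L) ≤ 768 := by
      rw [h512] at hRsum; push_cast at hRsum; linarith [hsplit, hZsum]
    have : (#L : ℤ) ≤ 32 := by linarith
    exact_mod_cast le_antisymm (by exact_mod_cast this) (show 32 ≤ #L by omega)
  have hoff0 : ∑ x ∈ univ.filter (fun x => x ∉ Z), e x ^ 2 = 0 := by
    rw [h512] at hRsum; rw [hL32] at hLsum hRsum; push_cast at hLsum hRsum; linarith [hsplit, hZsum]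
  refine ⟨fun y hy => ?_, hL32⟩
  have hy' : y ∈ univ.filter (fun x => x ∉ Z) := by simp [hy]
  have := (sum_eq_zero_iff_of_nonneg (fun x _ => sq_nonneg (e x))).1 hoff0 y hy'
  exact (pow_eq_zero_iff two_ne_zero).1 this

/-- **The same for the other side** (`Φ(g,f) = Φ(f,g)`): `f` is also at level `≥ 6` in one of the configurations (β), (γ), (δ₀). [this work] -/
theorem tw23_boundary_reduction_symm (f g : (Fin (6 + 6) → Bool) → Bool) (hf : IsDegLeFun 3 f) (hg : IsDegLeFun 3 g)
    (hΦ : (29 / 32 : ℝ) ≤ forrelation f g) (hhi : forrelation f g < 1) :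
    ∃ wf : (Fin (6 + 6) → Bool) → ℤ, (∀ y, W (fun x => signOf (f x)) y = (2 : ℝ) ^ 6 * (wf y : ℝ)) ∧
      forrelation g f = 29 / 32 ∧ (∑ y, (wf y - sZ (g y)) ^ 2 : ℤ) = 768 ∧
      (#(univ.filter fun y : Fin (6 + 6) → Bool => ¬ Odd (wf y)) = 768 ∨
       (#(univ.filter fun y : Fin (6 + 6) → Bool => ¬ Odd (wf y)) = 512 ∧
          ∑ y ∈ univ.filter (fun y => y ∉ (univ.filter fun y : Fin (6 + 6) → Bool => ¬ Odd (wf y))), (wf y - sZ (g y)) ^ 2 = 256) ∨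
       (#(univ.filter fun y : Fin (6 + 6) → Bool => ¬ Odd (wf y)) = 512 ∧
          (∀ y, y ∉ (univ.filter fun y : Fin (6 + 6) → Bool => ¬ Odd (wf y)) → wf y - sZ (g y) = 0) ∧
          #((univ.filter fun y : Fin (6 + 6) → Bool => ¬ Odd (wf y)).filter fun y =>
            Odd ((wf y - sZ (g y) - sZ (decide ((wf y - sZ (g y)) % 4 = 3))) / 4)) = 32)) := by
  have hΦ' : forrelation g f = forrelation f g := by
    rw [Summit.QuantumAdvantage.QuantumAdvantage.Theorems.SignedCubicForrelationNotPrBPP.Negative.HalfQuad.forrelation_comm]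
  exact tw23_boundary_reduction g f hg hf (by rw [hΦ']; exact hΦ) (by rw [hΦ']; exact hhi)

end Summit.QuantumAdvantage.QuantumAdvantage.Theorems.CubicForrelation.NearExactIsExact

end
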